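import Summits.BirchSwinnertonDyer.BirchSwinnertonDyer.Theorems.SignedLowerHalvesKobayashiLowerHalfLargeImageMuPartSqueeze
import Summits.BirchSwinnertonDyer.BirchSwinnertonDyer.Theorems.SignedLowerHalvesKobayashiMainConjectureSmallImageTeichOrbitMuLevel
import HarnessLib

/-!
# Route `SignedLowerHalves`, crux 3 `KobayashiLowerHalfLargeImage` (item stmt-BirchSwinnertonDyer-19001):
# the μ-floor / μ-part / sign-blind squeeze at `p ≥ 5` from B⁰ AT ONE LEVEL or from ONE ORBIT-SUM CERTIFICATE (per pair,
# PUBLISHED facts only) — instead of the class-wide Conjecture B⁰ `TeichSpanGenAll`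
# (cell `bsd-ssimc`, width seat `bsd-line-slh-p1-w6` gen 0; helper file `--supports 19001`; THEOREMS ONLY)

HONEST FRAMING.  The crux is OPEN and nothing here proves it; BSD is not proved by any of this.  This file only re-plugs the
μ-floor hypothesis `hfloor` of this seat's `…_of_muFloor` cores (`LargeImageMuPart`, `LargeImageMuPartSqueeze`) with the two
SHARPER suppliers landed by slh-p3 gen 9 (`SmallImageTeichOrbitMuLevel`): B⁰ at the newform's OWN level (`TeichSpanGen N_W p`, or
any one multiple prime to `p`), and — with NO conjecture at all — ONE explicit pair of Teichmüller-orbit sums of the newform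
differing by a rational of `p`-adic norm `≥ 1` (a finite modular-symbol computation per pair).

* §1 μ-floor suppliers at `(W, p)`, sign before newform: `signedMuFloor_of_teichSpanGen_conductor`,
  `signedMuFloor_of_teichSpanGen_of_dvd`, `signedMuFloor_of_exists_teichOrbitSum_sub` (certificate on the newform `f₀`).
* §2 consumers, PUBLISHED facts `h12`, `h41`, `h5`, `h3`, `hJ` only (no B⁰): `mu_charGen_eq_mu_kobayashiL_of_exists_teichOrbitSum_sub`
  (μ-part both signs from one orbit-sum certificate), **`kobayashiMainConjecture_forall_of_teichOrbitSum_cert_of_lam_le_mordellWeilRank`**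
  (ONE orbit-sum certificate + ONE inequality `λ(L_p^{ε₁}) ≤ rank E(ℚ)` ⟹ Kobayashi's main conjecture for BOTH signs — the fully
  per-pair certifiable form at `p ≥ 5`), and the conductor-level B⁰ forms.

CALIBRATION / SUPPORT ONLY (pen rule D34-4 (3)).  PER PAIR in the certificates; CLASS-WIDE otherwise.

References: [MazurTateTeitelbaum1986Invent] §I.10 (10.1); [Pollack2003] Def. 6.15, Rem. 6.16, Prop. 6.18; [PollackWeston2011]
Thm. 4.1 (1), Rem. 4.2; [Manin1972] Prop. 1.4; [Kobayashi2003] Conjecture (p. 2), Thm. 1.2, Thm. 4.1; [GreenbergLNM1716] §3 Lemma 3.1.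
-/

-- D-0017: single-problem summit, the namespace repeats the problem name by design.
set_option linter.dupNamespace false
set_option autoImplicit false

noncomputable section

open scoped Classical MatrixGroups ModularForm

open CongruenceSubgroup WeierstrassCurve Literature.NumberTheory.EllipticCurves
  Literature.NumberTheory.EllipticCurves.ModularForms
  Literature.NumberTheory.EllipticCurves.Kobayashi2003 Literature.NumberTheory.EllipticCurves.GreenbergVatsal2000
  Literature.NumberTheory.EllipticCurves.Rank1Residual ZpExtension
  Summit.BirchSwinnertonDyer.Rank1Residual.Supersingular

namespace Summit.BirchSwinnertonDyer.BirchSwinnertonDyer.Theorems.LargeImageMuFloorLevel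

open Summit.BirchSwinnertonDyer.Rank1Residual.X1.MuLambda (mu lam)
open Summit.BirchSwinnertonDyer.BirchSwinnertonDyer.Cruxes.AnalyticMuZeroX9.TeichSpan (TeichSpanGen)
open Summit.BirchSwinnertonDyer.BirchSwinnertonDyer.Theorems.LargeImageMuFloor
  (exists_sign_forall_isPollackPair_hasUnitContent exists_sign_forall_isNewformOf)
open Summit.BirchSwinnertonDyer.BirchSwinnertonDyer.Theorems.SmallImageTeichOrbitMuLevel
  (exists_sign_hasUnitContent_of_exists_teichOrbitSum_sub exists_sign_hasUnitContent_of_teichSpanGen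
    exists_sign_hasUnitContent_of_teichSpanGen_of_dvd)
open Summit.BirchSwinnertonDyer.BirchSwinnertonDyer.Theorems.LargeImageMuPart (mu_charGen_eq_mu_kobayashiL_of_muFloor)
open Summit.BirchSwinnertonDyer.BirchSwinnertonDyer.Theorems.LargeImageMuPartSqueeze
  (kobayashiMainConjecture_forall_of_lam_le_mordellWeilRank_of_muFloor)

variable {p : ℕ} [Fact p.Prime] {W : WeierstrassCurve ℚ} [W.IsElliptic] [W.IsGloballyMinimal]

/-! ## §1 Sharper μ-floor suppliers at `p ≥ 5` -/

/-- **μ-floor at `(W, p)` from B⁰ at the CONDUCTOR level only** (`TeichSpanGen N_W p`; slh-p3's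
`exists_sign_hasUnitContent_of_teichSpanGen` read through the uniqueness dictionary, sign before newform): `p ≥ 5` good,
`a_p = 0`. [cite: MazurTateTeitelbaum1986Invent, §I.10 (10.1)] [cite: Manin1972, Prop. 1.4] -/
theorem signedMuFloor_of_teichSpanGen_conductor (hp5 : 5 ≤ p) (hgood : W.HasGoodReductionAtPrime p)
    (hap : W.frobeniusTrace p = 0) (hB : TeichSpanGen (W.conductorNorm ℤ) p) :
    ∃ ε : ℤˣ, ∀ [NeZero (W.conductorNorm ℤ)] (f : CuspForm (Gamma0 (W.conductorNorm ℤ)) 2),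
      IsNewformOf W f → ∀ Lplus Lminus : IwasawaAlgebra p, IsPollackPair f p Lplus Lminus →
        HasUnitContent (kobayashiL ε Lplus Lminus) :=
  exists_sign_forall_isNewformOf
    (fun ε f ↦ ∀ Lplus Lminus : IwasawaAlgebra p, IsPollackPair f p Lplus Lminus →
      HasUnitContent (kobayashiL ε Lplus Lminus))
    (fun f hf ↦ exists_sign_forall_isPollackPair_hasUnitContent
      (exists_sign_hasUnitContent_of_teichSpanGen f hp5 hf hgood hap hB))

/-- **μ-floor at `(W, p)` from B⁰ at ANY ONE multiple `N′` of the conductor with `p ∤ N′`** (level descent, slh-p3 / bsd-idea-13).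
[cite: Manin1972, Prop. 1.4] [cite: MazurTateTeitelbaum1986Invent, §I.10 (10.1)] -/
theorem signedMuFloor_of_teichSpanGen_of_dvd (hp5 : 5 ≤ p) (hgood : W.HasGoodReductionAtPrime p)
    (hap : W.frobeniusTrace p = 0) {N' : ℕ} (hNN' : W.conductorNorm ℤ ∣ N') (hpN' : ¬ p ∣ N') (hB : TeichSpanGen N' p) :
    ∃ ε : ℤˣ, ∀ [NeZero (W.conductorNorm ℤ)] (f : CuspForm (Gamma0 (W.conductorNorm ℤ)) 2),
      IsNewformOf W f → ∀ Lplus Lminus : IwasawaAlgebra p, IsPollackPair f p Lplus Lminus →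
        HasUnitContent (kobayashiL ε Lplus Lminus) :=
  exists_sign_forall_isNewformOf
    (fun ε f ↦ ∀ Lplus Lminus : IwasawaAlgebra p, IsPollackPair f p Lplus Lminus →
      HasUnitContent (kobayashiL ε Lplus Lminus))
    (fun f hf ↦ exists_sign_forall_isPollackPair_hasUnitContent
      (exists_sign_hasUnitContent_of_teichSpanGen_of_dvd f hp5 hf hgood hap hNN' hpN' hB))

/-- **μ-floor at `(W, p)` from ONE ORBIT-SUM CERTIFICATE on the newform `f₀`** (no conjecture): `p` odd good, `a_p = 0`, and one pair of
Teichmüller-orbit sums `S_{f₀}(p,n,a), S_{f₀}(p,n,a′)`, `n ≥ 1`, differing by a rational of `p`-adic norm `≥ 1`.  The certificate is on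
`f₀`; the conclusion is for every newform of `W` (they coincide, `IsNewformOf.unique`) and every Pollack pair.
[cite: MazurTateTeitelbaum1986Invent, §I.10 (10.1)] [cite: Pollack2003, Def. 6.15 and Remark 6.16] [cite: PollackWeston2011, Thm. 4.1 (1)] -/
theorem signedMuFloor_of_exists_teichOrbitSum_sub (hp2 : p ≠ 2) (hgood : W.HasGoodReductionAtPrime p)
    (hap : W.frobeniusTrace p = 0) [NeZero (W.conductorNorm ℤ)] {f₀ : CuspForm (Gamma0 (W.conductorNorm ℤ)) 2}
    (hf₀ : IsNewformOf W f₀)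
    (hT : ∃ n : ℕ, 1 ≤ n ∧ ∃ a a' : (ZMod (p ^ n))ˣ,
      1 ≤ ‖((teichOrbitSum f₀ p n (a : ZMod (p ^ n)) - teichOrbitSum f₀ p n (a' : ZMod (p ^ n)) : ℚ) : ℚ_[p])‖) :
    ∃ ε : ℤˣ, ∀ [NeZero (W.conductorNorm ℤ)] (f : CuspForm (Gamma0 (W.conductorNorm ℤ)) 2),
      IsNewformOf W f → ∀ Lplus Lminus : IwasawaAlgebra p, IsPollackPair f p Lplus Lminus →
        HasUnitContent (kobayashiL ε Lplus Lminus) := by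
  obtain ⟨ε, hε⟩ := exists_sign_forall_isPollackPair_hasUnitContent
    (exists_sign_hasUnitContent_of_exists_teichOrbitSum_sub f₀ hp2 hf₀ hgood hap hT)
  refine ⟨ε, fun f hf ↦ ?_⟩
  have hff : f = f₀ := hf.unique hf₀
  subst hff
  exact hε

/-! ## §2 Consumers without Conjecture B⁰: PUBLISHED facts + a per-pair certificate -/

/-- **μ-PART (both signs) at `p ≥ 5` from ONE orbit-sum certificate**, modulo the PUBLISHED facts `h12`, `h41`, `h5`, `h3`, `hJ` only:
`μ(ξ^ε) = μ(L_p^ε)` for every sign, datum, generator (`p` odd good, `a_p = 0`, `ρ̄` onto).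
[cite: Kobayashi2003, Thm. 1.4 (the invariants), proof of Thm. 7.4 (p. 13)] [cite: MazurTateTeitelbaum1986Invent, §I.10 (10.1)] -/
theorem mu_charGen_eq_mu_kobayashiL_of_exists_teichOrbitSum_sub
    (h12 : Kobayashi2003.thm12_signedSelmerDual_finite_torsion)
    (h41 : Kobayashi2003.thm41_signedCharIdeal_divisibility)
    (h5 : realPeriodRat_eq_unit_mul_plusPeriod) (h3 : realPeriodRat_eq_unit_mul_plusPeriod_three)
    (hJ : Kobayashi2003.thm62_63_73_signedColemanKato_zetaJoint)
    (hp2 : p ≠ 2) (hgood : W.HasGoodReductionAtPrime p) (hap : W.frobeniusTrace p = 0) (hs : Surj W p)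
    [NeZero (W.conductorNorm ℤ)] {f₀ : CuspForm (Gamma0 (W.conductorNorm ℤ)) 2} (hf₀ : IsNewformOf W f₀)
    (hT : ∃ n : ℕ, 1 ≤ n ∧ ∃ a a' : (ZMod (p ^ n))ˣ,
      1 ≤ ‖((teichOrbitSum f₀ p n (a : ZMod (p ^ n)) - teichOrbitSum f₀ p n (a' : ZMod (p ^ n)) : ℚ) : ℚ_[p])‖)
    {κ : ZpExtension ℚ p} {γ : Field.absoluteGaloisGroup ℚ} (hκ : κ.IsCyclotomic)
    (hγ : κ.IsTopGenerator γ) (hγc : IsCyclotomicVariable p γ)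
    {f : CuspForm (Gamma0 (W.conductorNorm ℤ)) 2} (hf : IsNewformOf W f)
    {Lplus Lminus : IwasawaAlgebra p} (hPP : IsPollackPair f p Lplus Lminus)
    (ε : ℤˣ) (D : Kobayashi2003.SignedSelmerDualData W κ γ ε) {ξ : IwasawaAlgebra p}
    (hξ : D.charIdeal = Ideal.span {ξ}) :
    mu ξ = mu (kobayashiL ε Lplus Lminus) ∧ ξ ≠ 0 :=
  mu_charGen_eq_mu_kobayashiL_of_muFloor h12 h41 h5 h3 hJ
    (signedMuFloor_of_exists_teichOrbitSum_sub hp2 hgood hap hf₀ hT) hp2 hgood hap hs hκ hγ hγc hf hPP ε D hξ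

/-- **THE FULLY CERTIFIABLE SQUEEZE AT `p ≥ 5`: ONE orbit-sum certificate + ONE inequality `λ(L_p^{ε₁}) ≤ rank E(ℚ)` ⟹ Kobayashi's
main conjecture for BOTH signs**, modulo the PUBLISHED facts `h12`, `h41`, `h5`, `h3`, `hJ` only (no B⁰).  `p` odd good, `a_p = 0`,
`ρ̄_{E,p}` onto; certificates on the newform `f₀` (orbit sums) and in the `IsSignedPAdicLFunction` currency (`λ ≤ rank`).  PER PAIR.
[cite: Kobayashi2003, Conjecture (p. 2), Thm. 3.2, Thm. 4.1] [cite: GreenbergLNM1716, §3 Lemma 3.1] [cite: MazurTateTeitelbaum1986Invent, §I.10 (10.1)] -/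
theorem kobayashiMainConjecture_forall_of_teichOrbitSum_cert_of_lam_le_mordellWeilRank
    (h12 : Kobayashi2003.thm12_signedSelmerDual_finite_torsion)
    (h41 : Kobayashi2003.thm41_signedCharIdeal_divisibility)
    (h5 : realPeriodRat_eq_unit_mul_plusPeriod) (h3 : realPeriodRat_eq_unit_mul_plusPeriod_three)
    (hJ : Kobayashi2003.thm62_63_73_signedColemanKato_zetaJoint)
    (hp2 : p ≠ 2) (hgood : W.HasGoodReductionAtPrime p) (hap : W.frobeniusTrace p = 0) (hs : Surj W p)
    [NeZero (W.conductorNorm ℤ)] {f₀ : CuspForm (Gamma0 (W.conductorNorm ℤ)) 2} (hf₀ : IsNewformOf W f₀)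
    (hT : ∃ n : ℕ, 1 ≤ n ∧ ∃ a a' : (ZMod (p ^ n))ˣ,
      1 ≤ ‖((teichOrbitSum f₀ p n (a : ZMod (p ^ n)) - teichOrbitSum f₀ p n (a' : ZMod (p ^ n)) : ℚ) : ℚ_[p])‖)
    (ε₁ : ℤˣ) (hcert₀ : ∀ L : IwasawaAlgebra p, IsSignedPAdicLFunction f₀ p ε₁ L → lam L ≤ W.mordellWeilRank) :
    ∀ ε : ℤˣ, KobayashiMainConjecture W p ε := by
  refine kobayashiMainConjecture_forall_of_lam_le_mordellWeilRank_of_muFloor h12 h41 h5 h3 hJ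
    (signedMuFloor_of_exists_teichOrbitSum_sub hp2 hgood hap hf₀ hT) hp2 hgood hap hs ε₁ ?_
  intro _ f hf Lplus Lminus hPP
  have hff : f = f₀ := hf.unique hf₀
  subst hff
  exact hcert₀ _ (hPP.isSignedPAdicLFunction_kobayashiL ε₁)

/-- **The squeeze from B⁰ at the CONDUCTOR level** (`TeichSpanGen N_W p`, `p ≥ 5`) + `λ(L_p^{ε₁}) ≤ rank E(ℚ)` for one sign ⟹
Kobayashi's main conjecture for both signs (PUBLISHED facts + B⁰ at ONE level).
[cite: Kobayashi2003, Conjecture (p. 2), Thm. 4.1] [cite: Manin1972, Prop. 1.4] [cite: GreenbergLNM1716, §3 Lemma 3.1] -/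
theorem kobayashiMainConjecture_forall_of_teichSpanGen_conductor_of_lam_le_mordellWeilRank
    (h12 : Kobayashi2003.thm12_signedSelmerDual_finite_torsion)
    (h41 : Kobayashi2003.thm41_signedCharIdeal_divisibility)
    (h5 : realPeriodRat_eq_unit_mul_plusPeriod) (h3 : realPeriodRat_eq_unit_mul_plusPeriod_three)
    (hJ : Kobayashi2003.thm62_63_73_signedColemanKato_zetaJoint)
    (hp5 : 5 ≤ p) (hgood : W.HasGoodReductionAtPrime p) (hap : W.frobeniusTrace p = 0) (hs : Surj W p)
    (hB : TeichSpanGen (W.conductorNorm ℤ) p) (ε₁ : ℤˣ)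
    (hcert : ∀ [NeZero (W.conductorNorm ℤ)] (f : CuspForm (Gamma0 (W.conductorNorm ℤ)) 2),
      IsNewformOf W f → ∀ Lplus Lminus : IwasawaAlgebra p, IsPollackPair f p Lplus Lminus →
        lam (kobayashiL ε₁ Lplus Lminus) ≤ W.mordellWeilRank) :
    ∀ ε : ℤˣ, KobayashiMainConjecture W p ε :=
  kobayashiMainConjecture_forall_of_lam_le_mordellWeilRank_of_muFloor h12 h41 h5 h3 hJ
    (signedMuFloor_of_teichSpanGen_conductor hp5 hgood hap hB) (by omega) hgood hap hs ε₁ hcert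

end Summit.BirchSwinnertonDyer.BirchSwinnertonDyer.Theorems.LargeImageMuFloorLevel

end
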